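import Literature.MathematicalPhysics.QuantumFieldTheory.Balaban1983to89.B9SupplySockB9P3ZdLocalLettersOfOps
import Literature.MathematicalPhysics.QuantumFieldTheory.Balaban1983to89.B9Eq343CutoffFamilyZd

/-!
# `Balaban1983to89.B9SupplySockB9P3ZdFrameXi` — [Balaban1985BackgroundPropagators] (3.43) p. 398 «‖ζ∇_U G(U)λ‖_β ≦ B₀(β₀)(Lʲη)^{1−β}(‖ζ‖^ξ_β + |ζ|)e^{−δ₀d(y,y′)}|λ|,
# ζ ∈ C₀^∞(Δ̃(y)), y ∈ Λ_j, ξ = L^{−j}»: EDITION Ξ OF THE `ℤᵈ` FRAME — the cut-off slot CARRIES ITS BLOCK and the cut-off norm is PRINT'S ξ-SCALED ONE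
# (`(Lʲη)^β·[ζ]_{β,η} + |ζ|` = `[ζ]_{β,ξ} + |ζ|`), so that the canonical lattice cut-offs `ζ_y` have norm `≤ 4^β + 1` UNIFORMLY in the member

statement-level skeleton of published theorems with citation tags; proofs where landed; nothing here is a claim about the
Yang–Mills mass gap

`[Balaban1985BackgroundPropagators]` ("B9", CMP **99** (1985) 389–434) p. 397 (3.40): the Hölder norm `‖f‖^ξ_β = sup |f(x) − f(x′)|∕|x − x′|^β_ξ` is taken in
the `ξ`-lattice units, and p. 398 (3.43) fixes `ξ = L^{−j}` for `y ∈ Λ_j` (lit-balaban r06 PRINT-EXACT, cell bus 2026-08-28 l.26723): `|x − x′|_ξ = |x − x′|∕(Lʲη)`,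
so `‖ζ‖^ξ_β = (Lʲη)^β · sup |ζ(x) − ζ(x′)|∕|x − x′|^β` with `|x − x′|` in `η`-units.  PDF held: `paper:balaban1985-cmp99-background-propagators` pp. 397–398.

WHY THIS FILE (cell `pub-ymgap`, HUMAN RULING D-0062 ∕ D-0149; seat `pub-ymgap-dag-n06-w2` (g3), node N06 = [B9]; CLAIM-4, file X1; count-neutral).  The tree's frame
`B9SupplySockB9P3ZdFrame.geoZd` types the cut-off slot as `Cut := Site d → ℝ` with `cutH β ζ := cutHZd η β len ζ` — the `η`-SCALED seminorm `sup |ζ x − ζ x′|∕(η|x − x′|)^β`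
(no block is attached to a cut-off, so no `ξ`).  dag-n06-w2 g2 located (HOLDER-LINE-MEMO §2∕§6, `B9Eq343CutoffFamilyZd.le_cutHZd_zetaZd_l1Len`) that NO cut-off equal to
`1` on `Δ(y)` and supported in `Δ̃(y)` has a member-uniform `η`-scaled norm (`≥ ((⌊Lʲ∕4⌋ + 1)η)^{−β} → ∞` as `η → 0`), so the Hölder binder of the J-N06→N05
junction (`HolderAtδ2`, dag-n06-b) can only be discharged with a member-DEPENDENT constant at `geoZd` (`B9Eq343HolderDelta2ZdFinite`, g2).  This file types the
print-exact slot: `Cut := 𝔅 × (Site d → ℝ)`, `cutIn∕cutInT (y₀, ζ) y := y₀ = y ∧ supp ζ ⊂ Δ(y) ∕ Δ̃(y)`, `cutH β (y₀, ζ) := (L^{j_{y₀}}η)^β·[ζ]_{β,η} + |ζ|`, every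
other field of `geoZd` VERBATIM; the kernel family `GAZdXiOfOps` reads the SAME letters `eOfOps ∕ h1OfOps ∕ e4OfOps ∕ h2OfOps ∕ l2OfOps ∕ globZd` (the cut-off
argument through `ζ.2`).  The companion `B9Eq343HolderXiZdFinite` (X2) re-runs g2's summation at this frame.

WHAT IS TYPED ∕ PROVED (kernel, 0 sorry).
* §1 `cutHXi L η β len j ζ` (def: `(Lʲη)^β·sup_{AdmPair}|ζ x′ − ζ x|∕(η·len)^β + |ζ|`) · `cutHXi_nonneg` · ★★ `cutHXi_zetaZd_le` — the canonical cut-off of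
  `B9Eq343CutoffFamilyZd` has `cutHXi … j (ζ_{(j,y)}) ≤ 4^β + 1`, UNIFORMLY in `(d, L, η, j, y)` (`xiScaled_hquot_zetaZd_le` + `cutSupZd_zetaZd_le_one`) ·
  `cutHXi_eq_mul_cutHZd_add` (the dictionary with the `η`-scaled norm).
* §2 `geoZdXi 𝔸 L len x : B9.Geometry` (def) + rfl lemmas (`geoZdXi_M ∕ _eta ∕ _k ∕ _len ∕ _wNorm ∕ _cutH ∕ _cutInT_iff ∕ _cutIn_iff ∕ _suppIn ∕ _Loc`).
* §3 `GAZdXiOfOps ∕ GAZdXiFamOfOps` (defs) + rfl lemmas · ★ `ineq342Zd_of_ineq342Xi` (the (3.42)∕(3.46)∕(3.47) block at Ξ implies the block at `geoZd`: same `e`,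
  `glob`; the `l2` clause instantiated at `(y, h)`) · ★ `ineq343_h1_of_GAZdXiOfOps` (the (3.43) clause READ: for `ζ` supported in `Δ̃(y)`,
  `h1OfOps U J β ζ ≤ Bβ β · (Lʲη)^{1−β} · cutHXi … j ζ · e^{−δ₀d(y,y′)} · |J|`) · `dictGlob_zdXi` (the norm dictionary of the suppliers holds at Ξ by `rfl`).
HONEST SCOPE.  A re-typing of ONE slot of the tree's own frame to the printed norm; definitions + bookkeeping; no estimate of [B9] (Thm 3.3's (3.43) at Ξ is an
INPUT of the companion, not proved); count-neutral; N05∕N06 NOT discharged; one finite lattice programme at fixed `ε`; R4 closes the conditional finite-𝕋⁴ rung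
`BalabanLadder.UV` only; nothing continuum ∕ ℝ⁴ ∕ OS ∕ mass-gap ∕ Clay.  Unit `pub-ymgap-dag-n06-w2` (g3), 2026-08-28.
-/

noncomputable section

namespace Literature.MathematicalPhysics.QuantumFieldTheory.Balaban1983to89.B9SupplySockB9P3ZdFrameXi

open B7Prop2Explicit (unitaryUnits)
open B8Ineq132 (covDerivFwd BondTouches)
open B8Eq140Level (SideTouches)
open B8ScaledSupNorm (bondNorm msup)
open B8LeafModelZd (ZdIdx)
open B9Eq340HolderZd (AdmPair)
open B9SupplySockB9P3ZdLetters (OpsZd DictGlob)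
open B9SupplySockB9P3ZdFrame (MemberZd memZd memZd_M memZd_i memZd_m BSite blockZd blockTZd blockZd_subset_blockTZd bondTouches_mono CfgZd geoZd bgZd
  ιCfgZd ιLocZd ιCfgZd_val ιLocZd_eq distZd supNormZd l2NormZd cutHZd cutSupZd globZd GAZd_glob_zero GAZd_glob_one)
open B9SupplySockB9P3ZdLocalLettersOfOps (eOfOps h1OfOps e4OfOps h2OfOps l2OfOps glob2OfOps GAZdOfOps)
open B9Eq343CutoffFamilyZd (zetaZd xiScaled_hquot_zetaZd_le cutSupZd_zetaZd_le_one)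
open LatticeNorms (linfDist)

-- `Site` alone could resolve to the torus sites of `Setup.lean`; re-export the `ℤ^d` sites of `B7Prop1Explicit`.
export B7Prop1Explicit (Site)

variable {d : ℕ}

/-! ## §1 Print's ξ-scaled cut-off norm `‖ζ‖^ξ_β + |ζ|`, `ξ = L^{−j}` -/

section Norm

/-- **`‖ζ‖^ξ_β + |ζ|` WITH `ξ = L^{−j}`** («ζ ∈ C₀^∞(Δ̃(y)), y ∈ Λ_j, ξ = L^{−j}» in (3.43)): the Hölder seminorm of the site function `ζ` in the units of the
`ξ`-lattice — `(Lʲη)^β · sup_{x,x′ admissible} |ζ(x′) − ζ(x)| ∕ (η·len(x′ − x))^β` — plus its sup `|ζ|`; the tree's `η`-scaled `cutHZd η β len ζ` is the case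
`(Lʲη)^β ↦ 1`. [cite: Balaban1985BackgroundPropagators, (3.43) p.398, (3.40) p.397] -/
def cutHXi (L : ℕ) (η β : ℝ) (len : Site d → ℝ) (j : ℕ) (ζ : Site d → ℝ) : ℝ :=
  ((L : ℝ) ^ j * η) ^ β * (⨆ p : AdmPair η len, |ζ p.1.2 - ζ p.1.1| / (η * len (p.1.2 - p.1.1)) ^ β) + cutSupZd ζ

/-- `‖ζ‖^ξ_β + |ζ| ≥ 0` (`η ≥ 0`). [cite: Balaban1985BackgroundPropagators, (3.43) p.398 (bookkeeping)] -/
theorem cutHXi_nonneg (L : ℕ) {η : ℝ} (hη : 0 ≤ η) (β : ℝ) (len : Site d → ℝ) (j : ℕ) (ζ : Site d → ℝ) : 0 ≤ cutHXi L η β len j ζ := by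
  refine add_nonneg (mul_nonneg (Real.rpow_nonneg (by positivity) β) (Real.iSup_nonneg fun p => ?_)) (Real.iSup_nonneg fun z => abs_nonneg _)
  exact div_nonneg (abs_nonneg _) (Real.rpow_nonneg (mul_nonneg hη p.2.1.le) β)

/-- **THE DICTIONARY WITH THE TREE'S `η`-SCALED NORM**: `‖ζ‖^ξ_β + |ζ| = (Lʲη)^β · ([ζ]_{β,η}) + |ζ|` where `cutHZd η β len ζ = [ζ]_{β,η} + |ζ|`.
[cite: Balaban1985BackgroundPropagators, (3.43) p.398, (3.40) p.397] -/
theorem cutHXi_eq_mul_cutHZd_add (L : ℕ) (η β : ℝ) (len : Site d → ℝ) (j : ℕ) (ζ : Site d → ℝ) :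
    cutHXi L η β len j ζ = ((L : ℝ) ^ j * η) ^ β * (cutHZd η β len ζ - cutSupZd ζ) + cutSupZd ζ := by
  rw [cutHXi, cutHZd, add_sub_cancel_right]

/-- ★★ **THE CANONICAL LATTICE CUT-OFF HAS A MEMBER-UNIFORM PRINTED NORM**: for the ramp cut-off `ζ_y` of the level-`j` block at `y` (`B9Eq343CutoffFamilyZd.zetaZd`:
`= 1` on a core containing `Δ(y)`, supported in `Δ̃(y)`, ramp width `⌊Lʲ∕4⌋ + 1`), `‖ζ_y‖^ξ_β + |ζ_y| ≤ 4^β + 1` for `0 < η`, `0 ≤ β ≤ 1` and any length function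
dominating the sup-distance (`l1Len`, `euclidLen`) — INDEPENDENT of `η`, `j`, `y`, `L`, `d` (g2's `xiScaled_hquot_zetaZd_le` for the seminorm, `|ζ_y| ≤ 1` for
the sup).  At the `η`-scaled slot the same cut-off has norm `≥ ((⌊Lʲ∕4⌋ + 1)η)^{−β}` (`le_cutHZd_zetaZd_l1Len`). [cite: Balaban1985BackgroundPropagators, (3.43) p.398 («‖ζ‖^ξ_β + |ζ|»), (3.40) p.397] -/
theorem cutHXi_zetaZd_le (L j : ℕ) (y : Site d) {η β : ℝ} (hη : 0 < η) (hβ0 : 0 ≤ β) (hβ1 : β ≤ 1) {len : Site d → ℝ}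
    (hlen : ∀ z z' : Site d, (linfDist z z' : ℝ) ≤ len (z' - z)) :
    cutHXi L η β len j (zetaZd L j y) ≤ (4 : ℝ) ^ β + 1 := by
  unfold cutHXi
  refine add_le_add ?_ (cutSupZd_zetaZd_le_one L j y)
  have hs : 0 ≤ ((L : ℝ) ^ j * η) ^ β := Real.rpow_nonneg (by positivity) β
  -- the ξ-scaled quotients are bounded by `4^β` one by one, hence so is `(Lʲη)^β · sup`
  rcases isEmpty_or_nonempty (AdmPair η len) with hE | hE
  · rw [Real.iSup_of_isEmpty, mul_zero]
    exact Real.rpow_nonneg (by norm_num) β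
  · rw [Real.mul_iSup_of_nonneg hs]
    exact ciSup_le fun p => xiScaled_hquot_zetaZd_le j y hη hβ0 hβ1 hlen p.2

end Norm

/-! ## §2 Edition Ξ of the [B9] Sect. A geometry of a `ℤᵈ` member: the cut-off slot carries its block -/

section Geometry

variable (𝔸 : Type) [CStarAlgebra 𝔸] (L : ℕ) (len : Site d → ℝ)

/-- **THE [B9] SECT. A GEOMETRY OF THE `ℤᵈ` MEMBER, EDITION Ξ** — `B9SupplySockB9P3ZdFrame.geoZd` VERBATIM except for the cut-off slot: `Cut := 𝔅 × (Site d → ℝ)`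
(a cut-off comes WITH the block `y₀ ∈ 𝔅` it belongs to — print's «ζ ∈ C₀^∞(Δ̃(y)), y ∈ Λ_j»), `cutIn (y₀, ζ) y` = «`y₀ = y` and `supp ζ ⊂ Δ(y)`», `cutInT (y₀, ζ) y` =
«`y₀ = y` and `supp ζ ⊂ Δ̃(y)`», `cutH β (y₀, ζ) := ‖ζ‖^ξ_β + |ζ|` with `ξ = L^{−j_{y₀}}` (`cutHXi`), `cutSup (y₀, ζ) := |ζ|`.
[cite: Balaban1985BackgroundPropagators, Sect. A (3.39)–(3.41) p.397, (3.43) p.398, p.397 (Δ, Δ̃, 𝔅)] -/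
def geoZdXi (x : MemberZd d L) : B9.Geometry where
  Site := BSite L x
  scale y := y.1.1
  dist := distZd L x
  k := x.m
  eta := x.i.η
  L := L
  M := x.M
  Loc := Site d → Fin d → 𝔸
  suppIn J y := ∀ (z : Site d) (μ : Fin d), J z μ ≠ 0 → BondTouches (blockZd L y.1.1 y.1.2) z μ
  suppInT J y := ∀ (z : Site d) (μ : Fin d), J z μ ≠ 0 → BondTouches (blockTZd L y.1.1 y.1.2) z μ
  supNorm := supNormZd
  l2Norm := l2NormZd x.i.η
  wNorm γ J := bondNorm L x.m x.i.η γ x.i.Ω J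
  holder ε J := B9Eq340HolderZd.holder0 x.i.η ε len 1 J
  Cut := BSite L x × (Site d → ℝ)
  cutIn ζ y := ζ.1 = y ∧ ∀ z : Site d, ζ.2 z ≠ 0 → z ∈ blockZd L y.1.1 y.1.2
  cutInT ζ y := ζ.1 = y ∧ ∀ z : Site d, ζ.2 z ≠ 0 → z ∈ blockTZd L y.1.1 y.1.2
  cutH β ζ := cutHXi L x.i.η β len ζ.1.1.1 ζ.2
  cutSup ζ := cutSupZd ζ.2
  suppInT_of_suppIn _ y h z μ hz := bondTouches_mono (blockZd_subset_blockTZd L y.1.1 y.1.2) (h z μ hz)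
  cutInT_of_cutIn _ y h := ⟨h.1, fun z hz => blockZd_subset_blockTZd L y.1.1 y.1.2 (h.2 z hz)⟩

variable {𝔸 L len}

/-- `(geoZdXi … x).M = x.M`. [cite: Balaban1985BackgroundPropagators, Thm 3.1 p.397 (bookkeeping)] -/
theorem geoZdXi_M (x : MemberZd d L) : (geoZdXi 𝔸 L len x).M = x.M := rfl

/-- `(geoZdXi … x).eta = i.η`. [cite: Balaban1985BackgroundPropagators, (3.41) p.397 (bookkeeping)] -/
theorem geoZdXi_eta (x : MemberZd d L) : (geoZdXi 𝔸 L len x).eta = x.i.η := rfl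

/-- `(geoZdXi … x).k = m`. [cite: Balaban1985BackgroundPropagators, (3.41) p.397 (bookkeeping)] -/
theorem geoZdXi_k (x : MemberZd d L) : (geoZdXi 𝔸 L len x).k = x.m := rfl

/-- the scale length of a block: `len (j, y) = Lʲη`. [cite: Balaban1985BackgroundPropagators, (3.41) p.397] -/
theorem geoZdXi_len (x : MemberZd d L) (y : BSite L x) : (geoZdXi 𝔸 L len x).len y = (L : ℝ) ^ y.1.1 * x.i.η := rfl

/-- the weighted norm is the tree's `bondNorm` (untouched). [cite: Balaban1985BackgroundPropagators, (3.41) p.397] -/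
theorem geoZdXi_wNorm (x : MemberZd d L) (γ : ℝ) (J : Site d → Fin d → 𝔸) : (geoZdXi 𝔸 L len x).wNorm γ J = bondNorm L x.m x.i.η γ x.i.Ω J := rfl

/-- the cut-off norm of edition Ξ is the printed `‖ζ‖^ξ_β + |ζ|` at the level of the carried block. [cite: Balaban1985BackgroundPropagators, (3.43) p.398] -/
theorem geoZdXi_cutH (x : MemberZd d L) (β : ℝ) (ζ : BSite L x × (Site d → ℝ)) :
    (geoZdXi 𝔸 L len x).cutH β ζ = cutHXi L x.i.η β len ζ.1.1.1 ζ.2 := rfl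

/-- `cutSup (y₀, ζ) = |ζ|`. [cite: Balaban1985BackgroundPropagators, (3.46) p.398 («|h|»)] -/
theorem geoZdXi_cutSup (x : MemberZd d L) (ζ : BSite L x × (Site d → ℝ)) : (geoZdXi 𝔸 L len x).cutSup ζ = cutSupZd ζ.2 := rfl

/-- `cutInT (y₀, ζ) y ↔ y₀ = y ∧ supp ζ ⊂ Δ̃(y)`. [cite: Balaban1985BackgroundPropagators, (3.43) p.398 («ζ ∈ C₀^∞(Δ̃(y))»)] -/
theorem geoZdXi_cutInT_iff (x : MemberZd d L) (ζ : BSite L x × (Site d → ℝ)) (y : BSite L x) :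
    (geoZdXi 𝔸 L len x).cutInT ζ y ↔ ζ.1 = y ∧ ∀ z : Site d, ζ.2 z ≠ 0 → z ∈ blockTZd L y.1.1 y.1.2 := Iff.rfl

/-- `cutIn (y₀, h) y ↔ y₀ = y ∧ supp h ⊂ Δ(y)`. [cite: Balaban1985BackgroundPropagators, (3.46) p.398 («supp h ⊂ Δ(y)»)] -/
theorem geoZdXi_cutIn_iff (x : MemberZd d L) (ζ : BSite L x × (Site d → ℝ)) (y : BSite L x) :
    (geoZdXi 𝔸 L len x).cutIn ζ y ↔ ζ.1 = y ∧ ∀ z : Site d, ζ.2 z ≠ 0 → z ∈ blockZd L y.1.1 y.1.2 := Iff.rfl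

end Geometry

/-! ## §3 The kernel family of `G(U₀)` at edition Ξ, read off the operator; the readings; the norm dictionary -/

section Kernel

variable (𝔸 : Type) [CStarAlgebra 𝔸] (L : ℕ) (len : Site d → ℝ)

/-- **THE KERNEL FAMILY OF `G(U₀)` AT THE MEMBER, EDITION Ξ, EVERY ENTRY READ OFF THE OPERATOR** — `GAZdOfOps` VERBATIM, the Hölder entries (3.43)∕(3.45) and the
`L²` entries (3.46) reading the FUNCTION component `ζ.2` of the cut-off (the carried block `ζ.1` enters only the norm `cutH` and the support predicates).
[cite: Balaban1985BackgroundPropagators, (3.42)–(3.47) pp.397–398, Thm 3.3 p.399] -/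
def GAZdXiOfOps (x : MemberZd d L) (ops : OpsZd d 𝔸) : B9.KernelFamily (geoZdXi 𝔸 L len x) (bgZd 𝔸 L x) where
  e := eOfOps 𝔸 L ops x
  h1 U J β ζ := h1OfOps 𝔸 L len ops x U J β ζ.2
  e4 := e4OfOps 𝔸 L ops x
  h2 U J β ζ := h2OfOps 𝔸 L len ops x U J β ζ.2
  l2 n U J h := l2OfOps 𝔸 L ops x n U J h.2
  glob := globZd 𝔸 L x ops (glob2OfOps 𝔸 L ops x)

/-- **THE FAMILY OVER ALL MEMBERS, EDITION Ξ** — the `GA` slot of `B9.Thm33Printed c35 (geoZdXi 𝔸 L len) (bgZd 𝔸 L) Gp (GAZdXiFamOfOps 𝔸 L len ops)`.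
[cite: Balaban1985BackgroundPropagators, Thm 3.3 p.399] -/
def GAZdXiFamOfOps (ops : ℝ → ZdIdx d L → ℕ → OpsZd d 𝔸) (x : MemberZd d L) : B9.KernelFamily (geoZdXi 𝔸 L len x) (bgZd 𝔸 L x) :=
  GAZdXiOfOps 𝔸 L len x (ops x.M x.i x.m)

variable {𝔸 L len}

/-- the (3.42) entries at Ξ are `eOfOps` (as at `geoZd`). [cite: Balaban1985BackgroundPropagators, (3.42) p.397] -/
theorem GAZdXiOfOps_e (x : MemberZd d L) (ops : OpsZd d 𝔸) : (GAZdXiOfOps 𝔸 L len x ops).e = eOfOps 𝔸 L ops x := rfl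

/-- the (3.43) entry at Ξ reads `h1OfOps` at the function component. [cite: Balaban1985BackgroundPropagators, (3.43) p.398] -/
theorem GAZdXiOfOps_h1 (x : MemberZd d L) (ops : OpsZd d 𝔸) (U : CfgZd d 𝔸) (J : Site d → Fin d → 𝔸) (β : ℝ) (ζ : BSite L x × (Site d → ℝ)) :
    (GAZdXiOfOps 𝔸 L len x ops).h1 U J β ζ = h1OfOps 𝔸 L len ops x U J β ζ.2 := rfl

/-- the (3.45) entry at Ξ reads `h2OfOps` at the function component. [cite: Balaban1985BackgroundPropagators, (3.45) p.398] -/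
theorem GAZdXiOfOps_h2 (x : MemberZd d L) (ops : OpsZd d 𝔸) (U : CfgZd d 𝔸) (J : Site d → Fin d → 𝔸) (β : ℝ) (ζ : BSite L x × (Site d → ℝ)) :
    (GAZdXiOfOps 𝔸 L len x ops).h2 U J β ζ = h2OfOps 𝔸 L len ops x U J β ζ.2 := rfl

/-- the (3.46) entries at Ξ read `l2OfOps` at the function component. [cite: Balaban1985BackgroundPropagators, (3.46) p.398] -/
theorem GAZdXiOfOps_l2 (x : MemberZd d L) (ops : OpsZd d 𝔸) (n : Fin 6) (U : CfgZd d 𝔸) (J : Site d → Fin d → 𝔸) (h : BSite L x × (Site d → ℝ)) :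
    (GAZdXiOfOps 𝔸 L len x ops).l2 n U J h = l2OfOps 𝔸 L ops x n U J h.2 := rfl

/-- the (3.47) entries at Ξ are `globZd` (as at `geoZd`). [cite: Balaban1985BackgroundPropagators, (3.47) p.398] -/
theorem GAZdXiOfOps_glob (x : MemberZd d L) (ops : OpsZd d 𝔸) : (GAZdXiOfOps 𝔸 L len x ops).glob = globZd 𝔸 L x ops (glob2OfOps 𝔸 L ops x) := rfl

/-- `GAZdXiFamOfOps … ops (memZd M i m) = GAZdXiOfOps … (memZd M i m) (ops M i m)`. [cite: Balaban1985BackgroundPropagators, Thm 3.3 p.399 (bookkeeping)] -/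
theorem GAZdXiFamOfOps_memZd (ops : ℝ → ZdIdx d L → ℕ → OpsZd d 𝔸) (M : ℝ) (i : ZdIdx d L) (m : ℕ) :
    GAZdXiFamOfOps 𝔸 L len ops (memZd M i m) = GAZdXiOfOps 𝔸 L len (memZd M i m) (ops M i m) := rfl

/-- ★ **THE (3.42)∕(3.46)∕(3.47) BLOCK AT Ξ IMPLIES THE BLOCK AT `geoZd`**: the `e` and `glob` clauses are literally the same; the (3.46) clause at `geoZd` for a cut-off
`h` supported in `Δ(y)` is the Ξ clause at the block-carrying cut-off `(y, h)` (`cutSup (y, h) = |h|`).  So every consumer of `Ineq342_346_347 (GAZdOfOps …)` (g2's sup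
road, `B0_nonneg_of_ineq342_zd`, …) is fed by the Ξ reading. [cite: Balaban1985BackgroundPropagators, (3.42), (3.46), (3.47) pp.397–398] -/
theorem ineq342Zd_of_ineq342Xi {x : MemberZd d L} {ops : OpsZd d 𝔸} {B₀ δ₀ : ℝ} {U : CfgZd d 𝔸}
    (h : B9.Ineq342_346_347 (GAZdXiOfOps 𝔸 L len x ops) B₀ δ₀ U) : B9.Ineq342_346_347 (GAZdOfOps 𝔸 L len x ops) B₀ δ₀ U := by
  refine ⟨fun n J y y' hJ => h.1 n J y y' hJ, fun n J hcut y y' hh hJ => ?_, fun n J γ hγ hγ' => h.2.2 n J γ hγ hγ'⟩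
  exact h.2.1 n J (y, hcut) y y' ⟨rfl, hh⟩ hJ

/-- ★ **THE (3.42) CLAUSE AT Ξ, READ** (identical to `ineq342_of_GAZdOfOps`). [cite: Balaban1985BackgroundPropagators, (3.42) p.397, Thm 3.3 p.399] -/
theorem ineq342_of_GAZdXiOfOps {x : MemberZd d L} {ops : OpsZd d 𝔸} {B₀ δ₀ : ℝ} {U : CfgZd d 𝔸}
    (h : B9.Ineq342_346_347 (GAZdXiOfOps 𝔸 L len x ops) B₀ δ₀ U) (n : Fin 4) (J : Site d → Fin d → 𝔸) (y y' : BSite L x)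
    (hJ : ∀ (z : Site d) (μ : Fin d), J z μ ≠ 0 → BondTouches (blockZd L y'.1.1 y'.1.2) z μ) :
    eOfOps 𝔸 L ops x n U J y ≤ B₀ * B9.pref4 ((L : ℝ) ^ y.1.1 * x.i.η) n * Real.exp (-(δ₀ * distZd L x y y')) * supNormZd J :=
  h.1 n J y y' hJ

/-- ★ **THE (3.43) CLAUSE OF `B9.Ineq343_345 (GAZdXiOfOps …)`, READ** — print's (3.43) for the operator `ops.Gop` WITH PRINT'S NORM: for `0 ≤ β < 1`, a cut-off `ζ` supported
in `Δ̃(y)`, `y ∈ Λ_j`, and `J` supported on the bonds of `Δ(y′)`: `h1OfOps U J β ζ ≤ Bβ(β)·(Lʲη)^{1−β}·(‖ζ‖^ξ_β + |ζ|)·e^{−δ₀d(y,y′)}·|J|`, `ξ = L^{−j}` (the Ξ clause at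
the block-carrying cut-off `(y, ζ)`). [cite: Balaban1985BackgroundPropagators, (3.43) p.398, Thm 3.3 p.399] -/
theorem ineq343_h1_of_GAZdXiOfOps {x : MemberZd d L} {ops : OpsZd d 𝔸} {Bβ Bε : ℝ → ℝ} {Bεβ : ℝ → ℝ → ℝ} {δ₀ : ℝ} {U : CfgZd d 𝔸}
    (h : B9.Ineq343_345 (GAZdXiOfOps 𝔸 L len x ops) Bβ Bε Bεβ δ₀ U) (β : ℝ) (J : Site d → Fin d → 𝔸) (ζ : Site d → ℝ) (y y' : BSite L x)
    (hβ0 : 0 ≤ β) (hβ1 : β < 1) (hζ : ∀ z : Site d, ζ z ≠ 0 → z ∈ blockTZd L y.1.1 y.1.2)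
    (hJ : ∀ (z : Site d) (μ : Fin d), J z μ ≠ 0 → BondTouches (blockZd L y'.1.1 y'.1.2) z μ) :
    h1OfOps 𝔸 L len ops x U J β ζ ≤
      Bβ β * ((L : ℝ) ^ y.1.1 * x.i.η) ^ (1 - β) * cutHXi L x.i.η β len y.1.1 ζ * Real.exp (-(δ₀ * distZd L x y y')) * supNormZd J :=
  h.1 β J (y, ζ) y y' hβ0 hβ1 ⟨rfl, hζ⟩ hJ

/-- **THE NORM DICTIONARY OF THE SUPPLIERS HOLDS AT Ξ** (`DictGlob` — block parameter `M`, the `γ = −3` weighted norm, and the `γ = −3` global entries n = 0, 1, 3 of (3.47) —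
all untouched by the edition; same proof as `B9SupplySockB9P3ZdInstance.dictGlob_zd`), so `B9SupplySockB9P3ZdAt.dictAt_of_global` feeds every `…_at`-supplier of the junction
at the Ξ frame BY INSTANTIATION. [cite: Balaban1985BackgroundPropagators, (3.41) p.397, (3.47) p.398, Thm 3.3 p.399; Balaban1985RegularSpaces, (1.59) p.86] -/
theorem dictGlob_zdXi (ops : ℝ → ZdIdx d L → ℕ → OpsZd d 𝔸) :
    DictGlob (geoZdXi 𝔸 L len) (bgZd 𝔸 L) (GAZdXiFamOfOps 𝔸 L len ops) L memZd (ιCfgZd 𝔸 L) (ιLocZd 𝔸 L len) ops := by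
  intro M i m
  refine ⟨rfl, fun U₀ hU₀ J => ⟨rfl, ?_, ?_, rfl⟩⟩
  · simp only [GAZdXiFamOfOps, GAZdXiOfOps_glob, globZd, memZd_M, memZd_i, memZd_m, ιCfgZd_val, ιLocZd_eq]
    norm_num
  · simp only [GAZdXiFamOfOps, GAZdXiOfOps_glob, globZd, memZd_M, memZd_i, memZd_m, ιCfgZd_val, ιLocZd_eq]
    norm_num

end Kernel

end Literature.MathematicalPhysics.QuantumFieldTheory.Balaban1983to89.B9SupplySockB9P3ZdFrameXi

end
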